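import Summits.QuantumFields.BalabanUV.Beta.EriceFlowEnclosureB12AsPrintedPointwiseCover
import Summits.QuantumFields.BalabanUV.Beta.EriceFlowEnclosureB12AsPrintedHistoryUniqueMono

/-!
# Beta / EriceFlowEnclosureB12AsPrintedPointwiseFading — WHAT (0.31) FORCES POINTWISE, part 6: LOCAL UNIQUENESS IS SIGN-FREE UNDER FADING MEMORY, and
# the END of the history reading: the g-UNIFORM THEOREM 2 + prover 1's COUPLING-CHART history moduli with FADING MEMORY (`T4CouplingMatching.HistLipschitz`,
# `FadingMemory`) + `Definitions` + (U) + `hrg` ⟹ THE AF LETTER `FlowStep.BetaAFH` — no uniqueness letter, no Markov letter, no injectivity, no sign assumed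
# (β-flow team, prover 2 = lower ∕ positivity side, unit `b2b-balaban-beta-bflow-p2`, gen 43; ROW AP-I × ROW U × node U2's letters; part 5 `…PointwiseCover` =
# coverage + the oscillation letter given local uniqueness; prover 1's gen 33 `…HistoryUnique` = uniqueness GIVEN the AF letter — here the AF letter along the
# comparison run is produced from Theorem 2's OWN (0.31) along the tuned run, closing the loop; witness side: part 4's two-coupling toy admits no
# coupling-chart modulus, `…PointwiseFadingWitness`)

HONEST FRAMING (page 1 of everything the β sub-cell writes): discharging `BetaPertH` makes Bałaban's UV stability UNCONDITIONAL — a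
real constructive-QFT result; it is NOT the continuum limit and NOT the Clay problem.  HONEST DEPENDENCY (cell reorg 2026-08-19,
verbatim): «continuum YM on T⁴ ⇐ BetaPertH ∧ nine spine estimates (0/9 proved); BetaPertH ⇐ (D1) ∧ (D4) ∧ CAP+tail; G-an2-4 gates
asym, D1 and NE2/3/4.»  THIS MODULE DISCHARGES NOTHING: bookkeeping from the NAMED FIELDS of the statement-exact typing of [I] =
T. Bałaban, Commun. Math. Phys. **109** (1987) [Balaban1987RG1] (`B12BetaAsPrinted`: `Definitions.d018 ∕ d020`, the tuned-run form of `Theorem2Statement` —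
Theorem 2 is STATED WITHOUT PROOF, p. 259; [Balaban1989LargeFieldII] p. 355 «has not been published yet») and node U2's HYPOTHESIS SHAPES
`T4CouplingMatching.HistLipschitz Λ γ β` (|β_{k+1}(p) − β_{k+1}(q)| ≤ Σ_i Λ k i |p_i − q_i| on ]0, γ]^{k+1}) and `FadingMemory C θ Λ` (0 ≤ Λ k i ≤ Cθ^{k−i}) — NONE
printed ([I] p. 298 says only that β_j *"depends also on all preceding coupling constants"*; GAPS G-t4-U2-2) —, plus prover 1's binder `hrg` and the
upper letter (U).  Every letter is a hypothesis on an abstract `Setting S`; nothing of Bałaban's objects is asserted.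

THE POINT.  Prover 1's `runs_eq_of_fadingMemory` (gen 33) makes two same-length runs pinned at the same renormalized g COINCIDE, provided the AF weight
sum Σ_i g_i² g′_i is small — and bounded that sum by γ³ + 2γ∕b from the AF LETTER `BetaLowerH b` for BOTH runs (`sum_weights_le`).  For the question «what
does (0.31) force?» that letter is the unknown.  But Theorem 2 supplies (0.31) along ITS OWN tuned run T ending at g: `1∕T_i² ≥ 1∕g² + b(K − i)`.  A
comparison run R inside ]0, g₂] pinned at the same g is a priori NOT asymptotically free — yet it cannot stray: subtracting the two (0.20)'s and
telescoping from the pinned end, `|1∕T_j² − 1∕R_j²| ≤ Σ_{l≥j} |β_{l+1}(T_{≤l}) − β_{l+1}(R_{≤l})| ≤ (K − j)·g₂C∕(1 − θ)` (coupling-chart moduli: each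
coordinate differs by at most g₂, row sums of Λ are ≤ C∕(1 − θ)) (§1 `disc_le_linear`), so `1∕R_j² ≥ 1∕g² + (b − g₂C∕(1 − θ))(K − j) ≥ 1∕g² + (b∕2)(K − j)`
once g₂C∕(1 − θ) ≤ b∕2: THE COMPARISON RUN IS AF AT HALF RATE (§1 `inv_sq_lower_of_comparison`).  Node U2's profile sum at base point g then bounds the
weight sum by g³ + 4g∕b (§1 `sum_weights_le_of_tuned`), which is SMALL FOR SMALL ENDPOINTS — exactly where local uniqueness is wanted: R = T
(§1 `runs_eq_of_discrete031_fadingMemory`), so in-]0, g₂]-interval runs with a common endpoint are unique for g₂ below an explicit threshold in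
(b, C, θ, γ_U, g₁) (§2 `localUnique_of_fadingMemory`, `exists_localUnique_of_fadingMemory`) — SIGN-FREE in its hypotheses.  Feeding part 5: the moduli
also give the oscillation letter with Λ_osc = C∕(1 − θ) (§3 `histOsc_of_fadingMemory`), hence the END (§3): **g-uniform Theorem 2 + `Definitions` + (U) +
`hrg` + `HistLipschitz` with `FadingMemory` on ]0, γ_U] ⟹ `BetaLowerH (β ln L − Cδ∕(1−θ)) δ ∧ BetaUpperH (β′ ln L + Cδ∕(1−θ)) δ` for all small δ, and
`BetaAFH S.β`.**  Against parts 1∕2 (Markov + injectivity) and part 5 (local uniqueness assumed): the only structural letter left is a coupling-chart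
modulus whose memory fades — the history-reading form of row U's x-modulus; part 4's two-coupling toy (¬`BetaSignH` with everything else) has NO
coupling-chart modulus (`…PointwiseFadingWitness`), so the letter is load-bearing.

WHAT THIS FILE PROVES (0 sorry, 0 def):
§1 `rowSum_le` (Σ_{i≤k} Λ k i ≤ C∕(1 − θ)), **`disc_le_linear`** (pinned same-length runs in ]0, g₂]: |1∕g_j² − 1∕g′_j²| ≤ (K − j)·g₂C∕(1 − θ)),
   **`inv_sq_lower_of_comparison`** (the comparison run is AF at rate b∕2), **`sum_weights_le_of_tuned`** (Σ_{i≤K} g_i² g′_i ≤ g_K³ + 4g_K∕b),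
   **`runs_eq_of_discrete031_fadingMemory`** (⟹ the runs coincide, by prover 1's `runs_eq_of_fadingMemory`).
§2 **`localUnique_of_fadingMemory`** (carrier: Theorem 2's tuned runs at (γ, g₁, b, b′) + `hrg` + moduli on ]0, γ_U] + `Definitions` ⟹ uniqueness of
   in-]0, g₂]-interval runs with a common endpoint, for every g₂ ≤ min(γ_U, g₁) with g₂C∕(1−θ) ≤ b∕2 and C(g₂³ + 4g₂∕b) ≤ (1−θ)∕2),
   **`exists_localUnique_of_fadingMemory`** (such g₂ > 0 exists).
§3 `histOsc_of_fadingMemory`, **`letters_of_uniformTheorem2_fadingMemory`**, **`betaAFH_of_uniformTheorem2_fadingMemory`** (THE END).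
NOT CLAIMED: any modulus, sign or bound for Bałaban's β; Theorem 2; `BetaPertH`; continuum; Clay.
-/

namespace Summit.QuantumFields.BalabanUV.Beta.EriceFlowEnclosureB12AsPrintedPointwiseFading

open Finset
open Literature.MathematicalPhysics.QuantumFieldTheory.Balaban1983to89
open Literature.MathematicalPhysics.QuantumFieldTheory.Balaban1983to89.B12BetaAsPrinted
open Literature.MathematicalPhysics.QuantumFieldTheory.Balaban1983to89.FlowStep (prefixOf Box mem_box box_mono BetaLowerH BetaUpperH
  BetaSignH BetaAFH RGEqH)
open Literature.MathematicalPhysics.QuantumFieldTheory.Balaban1983to89.T4CouplingMatching (HistLipschitz FadingMemory prof sprof sprof_pos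
  sprof_sq prof_pos sum_profWeights_le)
open Summit.QuantumFields.BalabanUV.Beta.EriceFlowEnclosureB12AsPrintedTunedUpper (prefixOf_mem_box_of_inInterval)
open Summit.QuantumFields.BalabanUV.Beta.EriceFlowEnclosureB12AsPrintedHistoryUnique (runs_eq_of_fadingMemory)
open Summit.QuantumFields.BalabanUV.Beta.EriceFlowEnclosureB12AsPrintedHistoryUniqueMono (geom_tail_le)
open Summit.QuantumFields.BalabanUV.Beta.EriceFlowEnclosureB12AsPrintedPointwiseCover (le_endpoint_of_discrete031 cover
  letters_of_uniformTheorem2_unique_histOsc betaAFH_of_uniformTheorem2_unique_histOsc)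

noncomputable section

variable {S : Setting}

/-! ## §1 Two pinned runs of the same length, one of them (0.31)-tuned: the comparison run is AF at half rate, and they coincide -/

/-- Row sums of a fading-memory modulus: `Σ_{i≤k} Λ k i ≤ C∕(1 − θ)`. [folklore] -/
theorem rowSum_le {C θ : ℝ} {Λ : ℕ → ℕ → ℝ} (hθ0 : 0 ≤ θ) (hθ1 : θ < 1) (hC : 0 ≤ C) (hΛ : FadingMemory C θ Λ) (k : ℕ) :
    ∑ i : Fin (k + 1), Λ k i ≤ C / (1 - θ) := by
  rw [Fin.sum_univ_eq_sum_range (Λ k) (k + 1)]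
  calc ∑ i ∈ range (k + 1), Λ k i ≤ ∑ i ∈ range (k + 1), C * θ ^ (k - i) :=
        Finset.sum_le_sum fun i hi => (hΛ k i (Nat.lt_succ_iff.mp (mem_range.mp hi))).2
    _ = C * ∑ i ∈ range (k + 1), θ ^ (k + 1 - 1 - i) := by
        rw [Finset.mul_sum]; exact Finset.sum_congr rfl fun i _ => by rw [show k + 1 - 1 - i = k - i by omega]
    _ = C * ∑ i ∈ range (k + 1), θ ^ i := by rw [Finset.sum_range_reflect (fun i => θ ^ i) (k + 1)]
    _ ≤ C * (1 / (1 - θ)) := by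
        refine mul_le_mul_of_nonneg_left ?_ hC
        have h := geom_tail_le hθ0 hθ1 0 (k + 1)
        simp only [Nat.Ico_zero_eq_range, Nat.sub_zero] at h
        exact h
    _ = C / (1 - θ) := by ring

/-- **THE COMPARISON RUN CANNOT STRAY: a LINEAR-IN-DEPTH discrepancy bound.**  Two runs g, g′ of (0.20) of the same length K with the same history-dependent
β, couplings in ]0, g₂], pinned g_K = g′_K, coupling-chart moduli `HistLipschitz Λ g₂ S.β` with `FadingMemory C θ Λ`: for every j ≤ K,
`|1∕g_j² − 1∕g′_j²| ≤ (K − j)·(g₂C∕(1 − θ))` (subtract the two (0.20)'s, |g_i − g′_i| ≤ g₂ coordinatewise, row sums ≤ C∕(1 − θ), telescope from the pin).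
No sign of β, no smallness. [cite: Balaban1987RG1, (0.20) p.256 with p.298] -/
theorem disc_le_linear {g₂ θ C : ℝ} {Λ : ℕ → ℕ → ℝ} {K : ℕ} {g g' : ℕ → ℝ}
    (hθ0 : 0 ≤ θ) (hθ1 : θ < 1) (hC : 0 ≤ C)
    (hg : RGEqH K S.β g) (hg' : RGEqH K S.β g')
    (hbox : ∀ i, i ≤ K → 0 < g i ∧ g i ≤ g₂) (hbox' : ∀ i, i ≤ K → 0 < g' i ∧ g' i ≤ g₂) (hpin : g K = g' K)
    (hL : HistLipschitz Λ g₂ S.β) (hΛ : FadingMemory C θ Λ) {j : ℕ} (hj : j ≤ K) :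
    |1 / (g j) ^ 2 - 1 / (g' j) ^ 2| ≤ ((K : ℝ) - j) * (g₂ * C / (1 - θ)) := by
  -- one step: |Δβ_l| ≤ g₂ C/(1-θ)
  have hstep : ∀ l, l < K → |1 / (g l) ^ 2 - 1 / (g' l) ^ 2| ≤ |1 / (g (l + 1)) ^ 2 - 1 / (g' (l + 1)) ^ 2| + g₂ * C / (1 - θ) := by
    intro l hl
    have hp : prefixOf g l ∈ Box g₂ l := T4CouplingMatching.prefixOf_mem_box hl.le hbox
    have hp' : prefixOf g' l ∈ Box g₂ l := T4CouplingMatching.prefixOf_mem_box hl.le hbox'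
    have h2 := hL l (prefixOf g l) (prefixOf g' l) hp hp'
    have h3 : ∑ i : Fin (l + 1), Λ l i * |prefixOf g l i - prefixOf g' l i| ≤ (∑ i : Fin (l + 1), Λ l i) * g₂ := by
      rw [Finset.sum_mul]
      refine Finset.sum_le_sum fun i _ => mul_le_mul_of_nonneg_left ?_ (hΛ l i (Nat.lt_succ_iff.mp i.isLt)).1
      have hiK : (i : ℕ) ≤ K := by have := i.isLt; omega
      simp only [FlowStep.prefixOf_apply]
      rw [abs_sub_le_iff]
      constructor <;> linarith [(hbox i hiK).1, (hbox i hiK).2, (hbox' i hiK).1, (hbox' i hiK).2]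
    have h4 : (∑ i : Fin (l + 1), Λ l i) * g₂ ≤ C / (1 - θ) * g₂ :=
      mul_le_mul_of_nonneg_right (rowSum_le hθ0 hθ1 hC hΛ l) (le_trans (hbox 0 (Nat.zero_le _)).1.le (hbox 0 (Nat.zero_le _)).2)
    have key : 1 / g l ^ 2 - 1 / g' l ^ 2
        = (1 / g (l + 1) ^ 2 - 1 / g' (l + 1) ^ 2) + (S.β l (prefixOf g l) - S.β l (prefixOf g' l)) := by
      rw [hg l hl, hg' l hl]; ring
    rw [key]
    refine (abs_add_le _ _).trans ?_
    have : C / (1 - θ) * g₂ = g₂ * C / (1 - θ) := by ring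
    linarith [h2, h3, h4]
  -- telescope from the pin
  suffices H : ∀ d l, l + d = K → |1 / (g l) ^ 2 - 1 / (g' l) ^ 2| ≤ (d : ℝ) * (g₂ * C / (1 - θ)) by
    have h := H (K - j) j (Nat.add_sub_cancel' hj)
    rwa [Nat.cast_sub hj] at h
  intro d
  induction d with
  | zero => intro l hl; rw [add_zero] at hl; subst hl; simp [hpin]
  | succ d ih =>
    intro l hl
    have h1 := hstep l (by omega)
    have h2 := ih (l + 1) (by omega)
    push_cast
    linarith

/-- **THE COMPARISON RUN IS ASYMPTOTICALLY FREE AT HALF RATE.**  If moreover the run g carries (0.31)'s lower half relative to its own endpoint,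
`1∕g_K² + b(K − i) ≤ 1∕g_i²` (`Step.Discrete031 b b′ K (g K) g`), and `g₂C∕(1 − θ) ≤ b∕2`, then the comparison run g′ obeys
`1∕g′_K² + (b∕2)(K − i) ≤ 1∕g′_i²` for i ≤ K — and so does g. [cite: Balaban1987RG1, (0.31) p.259 with (0.20) p.256 and p.298] -/
theorem inv_sq_lower_of_comparison {g₂ θ C b b' : ℝ} {Λ : ℕ → ℕ → ℝ} {K : ℕ} {g g' : ℕ → ℝ}
    (hθ0 : 0 ≤ θ) (hθ1 : θ < 1) (hC : 0 ≤ C)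
    (hg : RGEqH K S.β g) (hg' : RGEqH K S.β g')
    (hbox : ∀ i, i ≤ K → 0 < g i ∧ g i ≤ g₂) (hbox' : ∀ i, i ≤ K → 0 < g' i ∧ g' i ≤ g₂) (hpin : g K = g' K)
    (hL : HistLipschitz Λ g₂ S.β) (hΛ : FadingMemory C θ Λ) (hD : Step.Discrete031 b b' K (g K) g)
    (hsmall : g₂ * C / (1 - θ) ≤ b / 2) {i : ℕ} (hi : i ≤ K) :
    1 / (g' K) ^ 2 + b / 2 * ((K : ℝ) - i) ≤ 1 / (g' i) ^ 2 ∧ 1 / (g K) ^ 2 + b / 2 * ((K : ℝ) - i) ≤ 1 / (g i) ^ 2 := by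
  have h1 := (hD i hi).1
  have h2 := abs_sub_le_iff.1 (disc_le_linear hθ0 hθ1 hC hg hg' hbox hbox' hpin hL hΛ hi)
  have hKi : (0 : ℝ) ≤ (K : ℝ) - i := sub_nonneg.2 (by exact_mod_cast hi)
  have hb : 0 ≤ b / 2 := by
    have : 0 ≤ g₂ * C / (1 - θ) := div_nonneg (mul_nonneg ((hbox 0 (Nat.zero_le _)).1.le.trans (hbox 0 (Nat.zero_le _)).2) hC)
      (by linarith)
    linarith
  rw [← hpin]
  constructor <;> nlinarith [mul_le_mul_of_nonneg_right hsmall hKi, h2.1, mul_nonneg hb hKi]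

/-- **THE AF WEIGHT SUM AT BASE POINT g_K**: for the tuned run g and the comparison run g′ of `inv_sq_lower_of_comparison` (b > 0),
`Σ_{i≤K} g_i² g′_i ≤ g_K³ + 4g_K∕b` — node U2's telescoped profile sum `sum_profWeights_le` with γ := g_K and rate b∕2 (prover 1's `sum_weights_le` reads the
profile off the AF LETTER for both runs; here it is read off (0.31) along g and the linear discrepancy bound for g′). [cite: Balaban1987RG1, (0.31) p.259] -/
theorem sum_weights_le_of_tuned {g₂ θ C b b' : ℝ} {Λ : ℕ → ℕ → ℝ} {K : ℕ} {g g' : ℕ → ℝ}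
    (hθ0 : 0 ≤ θ) (hθ1 : θ < 1) (hC : 0 ≤ C) (hb : 0 < b)
    (hg : RGEqH K S.β g) (hg' : RGEqH K S.β g')
    (hbox : ∀ i, i ≤ K → 0 < g i ∧ g i ≤ g₂) (hbox' : ∀ i, i ≤ K → 0 < g' i ∧ g' i ≤ g₂) (hpin : g K = g' K)
    (hL : HistLipschitz Λ g₂ S.β) (hΛ : FadingMemory C θ Λ) (hD : Step.Discrete031 b b' K (g K) g)
    (hsmall : g₂ * C / (1 - θ) ≤ b / 2) :
    ∑ i ∈ range (K + 1), (g i) ^ 2 * g' i ≤ (g K) ^ 3 + 4 * g K / b := by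
  have hγ : 0 < g K := (hbox K le_rfl).1
  have hb2 : 0 < b / 2 := by positivity
  have hp0 := sprof_pos hγ hb2.le
  have hpt : ∀ i, i ≤ K → (g i) ^ 2 * g' i ≤ 1 / (sprof (g K) (b / 2) (K - i)) ^ 2 * (1 / sprof (g K) (b / 2) (K - i)) := by
    intro i hi
    have hgi := hbox i hi
    have hgi' := hbox' i hi
    obtain ⟨h2, h1⟩ := inv_sq_lower_of_comparison hθ0 hθ1 hC hg hg' hbox hbox' hpin hL hΛ hD hsmall hi
    have hcast : ((K - i : ℕ) : ℝ) = (K : ℝ) - i := Nat.cast_sub hi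
    have ha : prof (g K) (b / 2) (K - i) ≤ 1 / (g i) ^ 2 := by unfold T4CouplingMatching.prof; rw [hcast]; exact h1
    have ha' : prof (g K) (b / 2) (K - i) ≤ 1 / (g' i) ^ 2 := by
      unfold T4CouplingMatching.prof; rw [hcast, hpin]; exact h2
    have hsq : (g i) ^ 2 ≤ 1 / (sprof (g K) (b / 2) (K - i)) ^ 2 := by
      rw [sprof_sq hγ hb2.le, le_one_div (pow_pos hgi.1 2) (prof_pos hγ hb2.le _)]; exact ha
    have hsq' : (g' i) ^ 2 ≤ (1 / sprof (g K) (b / 2) (K - i)) ^ 2 := by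
      rw [one_div_pow, sprof_sq hγ hb2.le, le_one_div (pow_pos hgi'.1 2) (prof_pos hγ hb2.le _)]; exact ha'
    have h' : g' i ≤ 1 / sprof (g K) (b / 2) (K - i) :=
      (pow_le_pow_iff_left₀ hgi'.1.le (one_div_pos.mpr (hp0 _)).le two_ne_zero).mp hsq'
    exact mul_le_mul hsq h' hgi'.1.le (by positivity)
  calc ∑ i ∈ range (K + 1), (g i) ^ 2 * g' i
      ≤ ∑ i ∈ range (K + 1), 1 / (sprof (g K) (b / 2) (K - i)) ^ 2 * (1 / sprof (g K) (b / 2) (K - i)) :=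
        Finset.sum_le_sum fun i hi => hpt i (Nat.lt_succ_iff.mp (mem_range.mp hi))
    _ ≤ (g K) ^ 3 + 2 * g K / (b / 2) := sum_profWeights_le hγ hb2 K
    _ = (g K) ^ 3 + 4 * g K / b := by ring

/-- **A (0.31)-TUNED RUN AND ANY COMPARISON RUN PINNED AT THE SAME SMALL ENDPOINT COINCIDE** (sign-free hypotheses).  Two runs of (0.20) of the same length K,
couplings in ]0, g₂], pinned g_K = g′_K, the first one (0.31)-tuned (`Step.Discrete031 b b′ K (g K) g`, b > 0); coupling-chart moduli with fading memory
on ]0, g₂]; smallness OF THE BOX AND OF THE ENDPOINT: `g₂C∕(1 − θ) ≤ b∕2` and `C(g_K³ + 4g_K∕b) ≤ (1 − θ)∕2`.  Then g_j = g′_j for all j ≤ K — prover 1's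
`runs_eq_of_fadingMemory` with the weight-sum bound of `sum_weights_le_of_tuned` in place of the AF letter. [cite: Balaban1987RG1, Thm 2 p.259 («g₀ = g₀(ε, g)») with (0.20) p.256 and p.298] -/
theorem runs_eq_of_discrete031_fadingMemory {g₂ θ C b b' : ℝ} {Λ : ℕ → ℕ → ℝ} {K : ℕ} {g g' : ℕ → ℝ}
    (hθ0 : 0 < θ) (hθ1 : θ < 1) (hC : 0 ≤ C) (hb : 0 < b)
    (hg : RGEqH K S.β g) (hg' : RGEqH K S.β g')
    (hbox : ∀ i, i ≤ K → 0 < g i ∧ g i ≤ g₂) (hbox' : ∀ i, i ≤ K → 0 < g' i ∧ g' i ≤ g₂) (hpin : g K = g' K)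
    (hL : HistLipschitz Λ g₂ S.β) (hΛ : FadingMemory C θ Λ) (hD : Step.Discrete031 b b' K (g K) g)
    (hsmall : g₂ * C / (1 - θ) ≤ b / 2) (hend : C * ((g K) ^ 3 + 4 * g K / b) ≤ (1 - θ) / 2) :
    ∀ j, j ≤ K → g j = g' j :=
  runs_eq_of_fadingMemory hθ0 hθ1 hC hg hg' hbox hbox' hpin hL hΛ
    (sum_weights_le_of_tuned hθ0.le hθ1 hC hb hg hg' hbox hbox' hpin hL hΛ hD hsmall) hend

/-! ## §2 On the carrier: local uniqueness near zero from Theorem 2's tuned runs and the moduli -/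

/-- **LOCAL UNIQUENESS OF THE IN-INTERVAL RUN, SIGN-FREE.**  Data: Theorem 2's tuned runs at interval γ for endpoints ≤ g₁ with constants b > 0, b′ (run
(K, m, g₀) inside ]0, γ], g_K = g, `Step.Discrete031 b b′ K g`); prover 1's binder `hrg` and node U2's moduli `HistLipschitz Λ γ_U S.β`, `FadingMemory C θ Λ` on
]0, γ_U]; the printed `Definitions` (`d018`).  Then for every g₂ ∈ ]0, min(γ_U, g₁)] with `g₂C∕(1 − θ) ≤ b∕2` and `C(g₂³ + 4g₂∕b) ≤ (1 − θ)∕2`: two rows (K, m, g₀),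
(K, m, g₀′) inside ]0, g₂] with the same g_K have g₀ = g₀′ (both coincide with the tuned run ending at g_K, which lies below g_K by (0.31)).  «g₀ = g₀(ε, g)» IS
a function near zero — with NO sign or lower bound on β assumed. [cite: Balaban1987RG1, Thm 2 p.259 («g₀ = g₀(ε, g)») with (0.18)–(0.20) pp.255–256 and p.298] -/
theorem localUnique_of_fadingMemory (hDef : Definitions S) {m : ℕ} {γ γU g₁ b b' θ C : ℝ} {Λ : ℕ → ℕ → ℝ}
    (hθ0 : 0 < θ) (hθ1 : θ < 1) (hC : 0 ≤ C) (hb : 0 < b)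
    (hrg : ∀ P : B12.RunParams, Step.InInterval γU P.K (S.cpl P) → RGEqH P.K S.β (S.cpl P))
    (hL : HistLipschitz Λ γU S.β) (hΛ : FadingMemory C θ Λ)
    (hT : ∀ g : ℝ, 0 < g → g ≤ g₁ → ∀ K : ℕ, ∃ g₀ : ℝ, Step.InInterval γ K (S.cpl ⟨K, m, g₀⟩) ∧
      S.cpl ⟨K, m, g₀⟩ K = g ∧ Step.Discrete031 b b' K g (S.cpl ⟨K, m, g₀⟩))
    {g₂ : ℝ} (hg₂U : g₂ ≤ γU) (hg₂g₁ : g₂ ≤ g₁) (hg₂C : g₂ * C / (1 - θ) ≤ b / 2)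
    (hg₂s : C * (g₂ ^ 3 + 4 * g₂ / b) ≤ (1 - θ) / 2)
    (K : ℕ) (g₀ g₀' : ℝ) (hI : Step.InInterval g₂ K (S.cpl ⟨K, m, g₀⟩)) (hI' : Step.InInterval g₂ K (S.cpl ⟨K, m, g₀'⟩))
    (he : S.cpl ⟨K, m, g₀⟩ K = S.cpl ⟨K, m, g₀'⟩ K) : g₀ = g₀' := by
  set e := S.cpl ⟨K, m, g₀⟩ K with hedef
  have hepos : 0 < e := (hI K le_rfl).1
  have heg₂ : e ≤ g₂ := (hI K le_rfl).2
  obtain ⟨g₀'', hIT, hTend, hDT⟩ := hT e hepos (heg₂.trans hg₂g₁) K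
  set T := S.cpl ⟨K, m, g₀''⟩ with hT'
  have hTbox : ∀ i, i ≤ K → 0 < T i ∧ T i ≤ g₂ := fun i hi =>
    ⟨(hIT i hi).1, (le_endpoint_of_discrete031 hb.le hepos hDT (fun j hj => (hIT j hj).1) hi).trans heg₂⟩
  have hLg₂ : HistLipschitz Λ g₂ S.β := fun k p q hp hq => hL k p q (box_mono hg₂U k hp) (box_mono hg₂U k hq)
  have hrgT : RGEqH K S.β T := hrg ⟨K, m, g₀''⟩ fun i hi => ⟨(hTbox i hi).1, (hTbox i hi).2.trans hg₂U⟩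
  have hDT' : Step.Discrete031 b b' K (T K) T := by rw [hTend]; exact hDT
  have hendT : C * ((T K) ^ 3 + 4 * T K / b) ≤ (1 - θ) / 2 := by
    refine le_trans (mul_le_mul_of_nonneg_left ?_ hC) hg₂s
    rw [hTend]
    have h3 : e ^ 3 ≤ g₂ ^ 3 := pow_le_pow_left₀ hepos.le heg₂ 3
    have h4 : 4 * e / b ≤ 4 * g₂ / b := div_le_div_of_nonneg_right (by linarith) hb.le
    linarith
  -- both given rows coincide with T
  have key : ∀ (a : ℝ), Step.InInterval g₂ K (S.cpl ⟨K, m, a⟩) → S.cpl ⟨K, m, a⟩ K = e → a = g₀'' := by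
    intro a hIa hae
    have hrga : RGEqH K S.β (S.cpl ⟨K, m, a⟩) := hrg ⟨K, m, a⟩ fun i hi => ⟨(hIa i hi).1, (hIa i hi).2.trans hg₂U⟩
    have h := runs_eq_of_discrete031_fadingMemory hθ0 hθ1 hC hb hrgT hrga hTbox hIa (hTend.trans hae.symm) hLg₂ hΛ hDT' hg₂C hendT
      0 (Nat.zero_le _)
    have h0 : S.cpl ⟨K, m, g₀''⟩ 0 = S.cpl ⟨K, m, a⟩ 0 := h
    rw [hDef.d018 ⟨K, m, g₀''⟩, hDef.d018 ⟨K, m, a⟩] at h0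
    exact h0.symm
  exact (key g₀ hI rfl).trans (key g₀' hI' he.symm).symm

/-- **… AND SUCH A BOX ]0, g₂] EXISTS**: under the data of `localUnique_of_fadingMemory` (0 < γ_U, 0 < g₁) some g₂ > 0 meets all four side conditions, so
in-]0, g₂]-interval runs with a common endpoint are unique — the LOCAL UNIQUENESS LETTER of part 5, DISCHARGED from the moduli.
[cite: Balaban1987RG1, Thm 2 p.259 («g₀ = g₀(ε, g)») with (0.20) p.256 and p.298] -/
theorem exists_localUnique_of_fadingMemory (hDef : Definitions S) {m : ℕ} {γ γU g₁ b b' θ C : ℝ} {Λ : ℕ → ℕ → ℝ}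
    (hθ0 : 0 < θ) (hθ1 : θ < 1) (hC : 0 ≤ C) (hb : 0 < b) (hγU : 0 < γU) (hg₁ : 0 < g₁)
    (hrg : ∀ P : B12.RunParams, Step.InInterval γU P.K (S.cpl P) → RGEqH P.K S.β (S.cpl P))
    (hL : HistLipschitz Λ γU S.β) (hΛ : FadingMemory C θ Λ)
    (hT : ∀ g : ℝ, 0 < g → g ≤ g₁ → ∀ K : ℕ, ∃ g₀ : ℝ, Step.InInterval γ K (S.cpl ⟨K, m, g₀⟩) ∧
      S.cpl ⟨K, m, g₀⟩ K = g ∧ Step.Discrete031 b b' K g (S.cpl ⟨K, m, g₀⟩)) :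
    ∃ g₂ : ℝ, 0 < g₂ ∧ ∀ (K : ℕ) (g₀ g₀' : ℝ), Step.InInterval g₂ K (S.cpl ⟨K, m, g₀⟩) →
      Step.InInterval g₂ K (S.cpl ⟨K, m, g₀'⟩) → S.cpl ⟨K, m, g₀⟩ K = S.cpl ⟨K, m, g₀'⟩ K → g₀ = g₀' := by
  have h1θ : 0 < 1 - θ := by linarith
  set A : ℝ := (C + 1) * (1 + 4 / b) with hA
  have hApos : 0 < A := by positivity
  set g₂ : ℝ := min (min γU g₁) (min 1 (min (b * (1 - θ) / (2 * (C + 1))) ((1 - θ) / (2 * A)))) with hg₂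
  have hg₂pos : 0 < g₂ := lt_min (lt_min hγU hg₁) (lt_min one_pos (lt_min (by positivity) (by positivity)))
  have hle1 : g₂ ≤ 1 := (min_le_right _ _).trans (min_le_left _ _)
  have hleC : g₂ ≤ b * (1 - θ) / (2 * (C + 1)) := (min_le_right _ _).trans ((min_le_right _ _).trans (min_le_left _ _))
  have hleA : g₂ ≤ (1 - θ) / (2 * A) := (min_le_right _ _).trans ((min_le_right _ _).trans (min_le_right _ _))
  refine ⟨g₂, hg₂pos, localUnique_of_fadingMemory hDef hθ0 hθ1 hC hb hrg hL hΛ hT ((min_le_left _ _).trans (min_le_left _ _))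
    ((min_le_left _ _).trans (min_le_right _ _)) ?_ ?_⟩
  · -- g₂ C/(1-θ) ≤ b/2
    rw [div_le_iff₀ h1θ]
    have h1 : g₂ * (2 * (C + 1)) ≤ b * (1 - θ) := (le_div_iff₀ (by positivity)).1 hleC
    nlinarith [mul_nonneg hg₂pos.le hC]
  · -- C (g₂³ + 4 g₂/b) ≤ (1-θ)/2
    have h3 : g₂ ^ 3 ≤ g₂ := by
      have : g₂ ^ 3 ≤ g₂ ^ 1 := pow_le_pow_of_le_one hg₂pos.le hle1 (by norm_num)
      simpa using this
    have h4 : C * (g₂ ^ 3 + 4 * g₂ / b) ≤ A * g₂ := by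
      have : C * (g₂ ^ 3 + 4 * g₂ / b) ≤ C * (g₂ + 4 * g₂ / b) := by
        refine mul_le_mul_of_nonneg_left (by linarith) hC
      have h5 : C * (g₂ + 4 * g₂ / b) = C * (1 + 4 / b) * g₂ := by ring
      have h6 : C * (1 + 4 / b) * g₂ ≤ (C + 1) * (1 + 4 / b) * g₂ := by
        refine mul_le_mul_of_nonneg_right (mul_le_mul_of_nonneg_right (by linarith) (by positivity)) hg₂pos.le
      linarith
    have h7 : A * g₂ ≤ (1 - θ) / 2 := by
      have := (le_div_iff₀ (by positivity : (0 : ℝ) < 2 * A)).1 hleA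
      linarith
    linarith

/-! ## §3 THE END of the history reading: the AF letter from the g-uniform Theorem 2 and coupling-chart fading memory alone -/

/-- Coupling-chart moduli with fading memory give part 5's OSCILLATION LETTER with Λ_osc = C∕(1 − θ): histories in ]0, δ]^{k+1} with the same last coupling
differ by at most δ in each preceding coordinate. [cite: Balaban1987RG1, p.298] -/
theorem histOsc_of_fadingMemory {γU θ C : ℝ} {Λ : ℕ → ℕ → ℝ} (hθ0 : 0 ≤ θ) (hθ1 : θ < 1) (hC : 0 ≤ C)
    (hL : HistLipschitz Λ γU S.β) (hΛ : FadingMemory C θ Λ) {δ : ℝ} (hδ : 0 < δ) (hδU : δ ≤ γU)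
    (k : ℕ) (p q : Fin (k + 1) → ℝ) (hp : p ∈ Box δ k) (hq : q ∈ Box δ k) (_h : p (Fin.last k) = q (Fin.last k)) :
    |S.β k p - S.β k q| ≤ C / (1 - θ) * δ := by
  have h2 := hL k p q (box_mono hδU k hp) (box_mono hδU k hq)
  have h3 : ∑ i : Fin (k + 1), Λ k i * |p i - q i| ≤ (∑ i : Fin (k + 1), Λ k i) * δ := by
    rw [Finset.sum_mul]
    refine Finset.sum_le_sum fun i _ => mul_le_mul_of_nonneg_left ?_ (hΛ k i (Nat.lt_succ_iff.mp i.isLt)).1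
    rw [abs_sub_le_iff]
    constructor <;> linarith [(mem_box.1 hp i).1, (mem_box.1 hp i).2, (mem_box.1 hq i).1, (mem_box.1 hq i).2]
  exact h2.trans (h3.trans (mul_le_mul_of_nonneg_right (rowSum_le hθ0 hθ1 hC hΛ k) hδ.le))

/-- **THE TWO-SIDED POINTWISE LETTERS FROM THE g-UNIFORM THEOREM 2 AND FADING MEMORY ALONE.**  `hTu` (part 2's reading of p. 259: «there exist constants β, β′»
before «for a sufficiently small positive g») + the printed `Definitions` + prover 1's binder `hrg` and an upper bound (U) on ]0, γ_U] + node U2's coupling-chart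
moduli `HistLipschitz Λ γ_U S.β` with `FadingMemory C θ Λ` ⟹ there are x₁ > 0 and Theorem 2's 0 < β ≤ β′ with, for every δ ∈ ]0, x₁],
**`BetaLowerH (β ln L − Cδ∕(1 − θ)) δ S.β ∧ BetaUpperH (β′ ln L + Cδ∕(1 − θ)) δ S.β`** (local uniqueness by §2, coverage and spreading by part 5).  NO uniqueness,
Markov, injectivity or sign letter among the hypotheses. [cite: Balaban1987RG1, Thm 2 (0.31) p.259 with (0.18)–(0.20) pp.255–256 and p.298] -/
theorem letters_of_uniformTheorem2_fadingMemory (hD : Definitions S)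
    (hTu : ∀ m : ℕ, ∃ γ₀ : ℝ, 0 < γ₀ ∧ ∀ γ : ℝ, 0 < γ → γ ≤ γ₀ → ∃ g₁ : ℝ, 0 < g₁ ∧ ∃ β β' : ℝ, 0 < β ∧ β ≤ β' ∧
      ∀ g : ℝ, 0 < g → g ≤ g₁ → ∀ K : ℕ, ∃ g₀ : ℝ, Step.InInterval γ K (S.cpl ⟨K, m, g₀⟩) ∧ S.cpl ⟨K, m, g₀⟩ K = g ∧
        Step.Discrete031 (β * Real.log S.L) (β' * Real.log S.L) K g (S.cpl ⟨K, m, g₀⟩))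
    (m : ℕ) (hL1 : 1 < S.L) {γU M θ C : ℝ} {Λ : ℕ → ℕ → ℝ} (hγU : 0 < γU) (hθ0 : 0 < θ) (hθ1 : θ < 1) (hC : 0 ≤ C)
    (hrg : ∀ P : B12.RunParams, Step.InInterval γU P.K (S.cpl P) → RGEqH P.K S.β (S.cpl P))
    (hub : BetaUpperH M γU S.β) (hL : HistLipschitz Λ γU S.β) (hΛ : FadingMemory C θ Λ) :
    ∃ x₁ β β' : ℝ, 0 < x₁ ∧ x₁ ≤ γU ∧ 0 < β ∧ β ≤ β' ∧ ∀ δ : ℝ, 0 < δ → δ ≤ x₁ →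
      BetaLowerH (β * Real.log S.L - C / (1 - θ) * δ) δ S.β ∧ BetaUpperH (β' * Real.log S.L + C / (1 - θ) * δ) δ S.β := by
  have hlog : 0 < Real.log (S.L : ℝ) := Real.log_pos (by exact_mod_cast hL1)
  obtain ⟨γ₀, hγ₀, hγ⟩ := hTu m
  obtain ⟨g₁, hg₁, β, β', hβ, -, hg⟩ := hγ (min γU γ₀) (lt_min hγU hγ₀) (min_le_right _ _)
  have huniq := exists_localUnique_of_fadingMemory hD hθ0 hθ1 hC (mul_pos hβ hlog) hγU hg₁ hrg hL hΛ hg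
  exact letters_of_uniformTheorem2_unique_histOsc hD hTu m hL1 hγU hrg hub
    (fun δ hδ hδU k p q hp hq h => histOsc_of_fadingMemory hθ0.le hθ1 hC hL hΛ hδ hδU k p q hp hq h) huniq

/-- **THE END OF THE HISTORY READING — THE AF LETTER `FlowStep.BetaAFH` IS NECESSARY UNDER FADING MEMORY**: g-uniform Theorem 2 + `Definitions` + (U) + `hrg` +
coupling-chart `HistLipschitz` with `FadingMemory` on ]0, γ_U] ⟹ `BetaAFH S.β`.  Compare part 2's `betaAFH_of_uniformTheorem2_markov` (Markov + injective one-step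
maps) and prover 1's `theorem2_existsUnique_of_fadingMemory` (uniqueness GIVEN the AF letter): here the moduli are the ONLY structural letter, and part 4's
two-coupling toy — g-uniform (0.31), all of [I]'s typed content, ¬`BetaSignH` — shows it cannot be dropped (it admits no coupling-chart modulus:
`…PointwiseFadingWitness`). [cite: Balaban1987RG1, Thm 2 (0.31) p.259 with p.298] -/
theorem betaAFH_of_uniformTheorem2_fadingMemory (hD : Definitions S)
    (hTu : ∀ m : ℕ, ∃ γ₀ : ℝ, 0 < γ₀ ∧ ∀ γ : ℝ, 0 < γ → γ ≤ γ₀ → ∃ g₁ : ℝ, 0 < g₁ ∧ ∃ β β' : ℝ, 0 < β ∧ β ≤ β' ∧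
      ∀ g : ℝ, 0 < g → g ≤ g₁ → ∀ K : ℕ, ∃ g₀ : ℝ, Step.InInterval γ K (S.cpl ⟨K, m, g₀⟩) ∧ S.cpl ⟨K, m, g₀⟩ K = g ∧
        Step.Discrete031 (β * Real.log S.L) (β' * Real.log S.L) K g (S.cpl ⟨K, m, g₀⟩))
    (m : ℕ) (hL1 : 1 < S.L) {γU M θ C : ℝ} {Λ : ℕ → ℕ → ℝ} (hγU : 0 < γU) (hθ0 : 0 < θ) (hθ1 : θ < 1) (hC : 0 ≤ C)
    (hrg : ∀ P : B12.RunParams, Step.InInterval γU P.K (S.cpl P) → RGEqH P.K S.β (S.cpl P))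
    (hub : BetaUpperH M γU S.β) (hL : HistLipschitz Λ γU S.β) (hΛ : FadingMemory C θ Λ) : BetaAFH S.β := by
  have hlog : 0 < Real.log (S.L : ℝ) := Real.log_pos (by exact_mod_cast hL1)
  obtain ⟨γ₀, hγ₀, hγ⟩ := hTu m
  obtain ⟨g₁, hg₁, β, β', hβ, -, hg⟩ := hγ (min γU γ₀) (lt_min hγU hγ₀) (min_le_right _ _)
  have huniq := exists_localUnique_of_fadingMemory hD hθ0 hθ1 hC (mul_pos hβ hlog) hγU hg₁ hrg hL hΛ hg
  exact betaAFH_of_uniformTheorem2_unique_histOsc hD hTu m hL1 hγU (div_nonneg hC (by linarith)) hrg hub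
    (fun δ hδ hδU k p q hp hq h => histOsc_of_fadingMemory hθ0.le hθ1 hC hL hΛ hδ hδU k p q hp hq h) huniq

end

end Summit.QuantumFields.BalabanUV.Beta.EriceFlowEnclosureB12AsPrintedPointwiseFading
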